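/-
Copyright (c) 2026 the pub-hodgecm-mathlib formalisation cell (harness21).  Prover seat hodgecm-mathlib-K2E4-p14 (g5), Track B ∕ K2-LIT, h413 =
`stmt-HodgeConjecture-24833`, line `K2_E1_TraceFormulaBeta`, campaign «EIS-RANK-ONE» rung R6f(ii) at `N = 2`; DEAL «MS-TWO» of the dealer K2E1-plan (g3) 2026-09-04T05:48:57Z,
file (1): the `U(J₂)` twin of ★ p857654 `K2E1MaassSelbergBracketsThree` (cut (C1) of «EIS-R6-CM»).
-/
import Summits.HodgeConjecture.HodgeConjecture.Theorems.K2E1MaassSelbergBracketsThree            -- ★ p857654 (this seat): (C1) at `N = 3` — its §0 pointwise lemmas are `N`-generic and REUSED here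
import Summits.HodgeConjecture.HodgeConjecture.Theorems.K2E1MaassSelbergUTwo                     -- ★ p857627 (this seat): `maassSelberg_inner_truncation_two` (the token shape served by §2)
import Summits.HodgeConjecture.HodgeConjecture.Theorems.K2E1EisensteinPairingUnfoldedWeightU2    -- ★ p857611 (K2E4-p11 g3): (δ)_two, the `B(F)`-weight-level entry at `N = 2` (weight `‖x‖⁻¹`)
import HarnessLib

/-!
# K2·E1 — `K2E1MaassSelbergBracketsTwo`: THE FOUR MAASS–SELBERG BRACKETS OF `U(J₂)` FOR FLAT SECTIONS, FROM THE `B(F)`-WEIGHT LEVEL TO THE IDELE CLASS GROUP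
# (campaign «EIS-RANK-ONE», rung R6f(ii), deal «MS-TWO» file (1): the `hδᵢ`∕`hiᵢ` inputs of ★ `maassSelberg_inner_truncation_two`, discharged over ★ (δ)_two p857611)

Track B ∕ K2-LIT, crux h413 = `stmt-HodgeConjecture-24833`, route of record `HCCMUnconditional`; cell `hodgecm-mathlib`, squad K2, ENGINE E1.  Prover seat
`hodgecm-mathlib-K2E4-p14` (g5); DEAL «MS-TWO» of the dealer K2E1-plan (g3) 2026-09-04T05:48:57Z = the `N = 2` twin chain of this seat's (C1)∕(C2)∕ED. 3, file (1).  THEOREMS ONLY (no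
`def`, no `instance`, no notation, no named-fact hypothesis, no `sorry`); lane `--supports stmt-HodgeConjecture-24833 --as helper` (count-neutral).  Closes no socket.  Generic
quadratic `(F, E, c)` with `c² = 1`, `c ≠ 1` (no `[E:F] = 2` binder is needed at `N = 2`; nothing CM-specific — CM enters file (2) through ★ R2 `…GodementCMTwo`).

THE MATHEMATICS [MoeglinWaldspurger1995, II.1.5, IV.2.1–IV.2.3; Arthur1980TraceFormulaII, §4; Garrett2018, §11.3].  `G = U(J₂)(𝔸_F)` (`F`-rank one, `2ρ_H = 1`), `H` the Borel
height, `K_U` the standard maximal compact, `d₀ : T(𝔸_F) → 𝕀_E` the first diagonal coordinate.  For a height cut-off `P ⊆ ℝ≥0` and two FLAT SECTIONS `f_a = α·H^a`,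
`f′_{a′} = α′·H^{a′}` (★ p857359 `flatSectionU`; `α, α′` Borel, bounded, left-`N(𝔸)`- and left-`B(F)`-invariant) the bracket integrand `Ψ = 𝟙_P(H)·f_a·conj f′_{a′}` has
`K_U`-average `𝟙_P(‖d₀ t‖)·‖d₀ t‖^{a + conj a′}·Ξ(d₀ t)` along the torus (★ (C1) §0, every `N`: `H(t k) = ‖d₀ t‖`, `conj (r^{a′}) = r^{conj a′}`) as soon as **(hΞ) the
`K_U`-average of `α·conj α′` along the torus is a function `Ξ` of `d₀ t`** — the ONE structural hypothesis, exactly as at `N = 3`.  Then ★ (δ)_two p857611 gives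
  **`∫ (β g)·Ψ(g) dν_G = K · ∫_{𝓕} ‖x‖⁻¹ • 𝟙_P(‖x‖)·‖x‖^{a + conj a′}·Ξ(x) dν_I`**, with `(β)·Ψ ∈ L¹(ν_G)`,
for ONE `K > 0` and every covering weight `β` of `B(F)♯`, under the honest finiteness `∫⁻_𝓕 ‖x‖⁻¹·𝟙_P·‖x‖^{Re(a+ā′)}·C_α C_α′ < ∞` (§1, the master lemma
`exists_integral_weight_smul_cutoff_flatSectionU_mul_conj_eq_two`).  §2 instantiates at `P = Iic T` and `P = Ioi T` in the EXACT token shape of ★ `maassSelberg_inner_truncation_two`'s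
`hδ₁…hδ₄` (`{x | (‖x‖:ℝ) ≤ (T:ℝ)}`, `{x | (T:ℝ) < (‖x‖:ℝ)}`, weight `‖x‖⁻¹`), discharging the finiteness by ★ p857444 `setLIntegral_indicator_ideleNorm_rpow_eq` (`Re(a + ā′) > 1`) resp.
★ p857517 `setLIntegral_indicator_lt_rpow_neg` (`Re(a + ā′) < 1`): for the four brackets `(α,a,α′,a′) = (φ,z,φ′,z′), (φ,z,φ̃′,1−z′), (φ̃,1−z,φ′,z′), (φ̃,1−z,φ̃′,1−z′)` the exponents
`a + conj a′` are `s₁+1, s₂+1, −s₂+1, −s₁+1` with `s₁ = z + conj z′ − 1`, `s₂ = z − conj z′`.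
HONEST LABEL: HC_CM is proved only modulo the 7 printed citations (2 remaining named inputs: hLiu418 = `stmt-HodgeConjecture-24832`, h413 = `stmt-HodgeConjecture-24833`) until rung 0
closes; this file asserts no named fact and closes no socket.
References: [MoeglinWaldspurger1995] C. Mœglin, J.-L. Waldspurger, *Spectral Decomposition and Eisenstein Series* (1995), II.1.5, IV.2.1–IV.2.3 · [Arthur1980TraceFormulaII] J. Arthur,
Compositio Math. 40 (1980), §4 · [Garrett2018] P. Garrett, *Modern Analysis of Automorphic Forms by Example* (2018), §11.3 · [Rogawski1990] §2.2, §7.3.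
-/

set_option autoImplicit false
-- the mandated namespace repeats the single-problem summit's segment (`HodgeConjecture.HodgeConjecture`)
set_option linter.dupNamespace false

noncomputable section

open MeasureTheory Measure NumberField IsDedekindDomain Set MulAction
open scoped ENNReal NNReal ComplexConjugate
open Literature.MeasureTheory.Group Literature.NumberTheory
open Literature.NumberTheory.Automorphic Literature.NumberTheory.Automorphic.UnitaryGroup AdelicGroupData
open Summit.HodgeConjecture.HodgeConjecture.Cruxes.H413.K2E1BorelEisensteinU
open Summit.HodgeConjecture.HodgeConjecture.Cruxes.H413.K2E1IdeleClassMellinWeighted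
open Summit.HodgeConjecture.HodgeConjecture.Cruxes.H413.K2E1TorusHeightMellin
open Summit.HodgeConjecture.HodgeConjecture.Cruxes.H413.K2E1BorelParabolicIntegralU2 (borelHeight_coe_eq_ideleNorm_diagUnit)
open Summit.HodgeConjecture.HodgeConjecture.Cruxes.H413.K2E1EisensteinPairingUnfoldedWeightU2
open Summit.HodgeConjecture.HodgeConjecture.Cruxes.H413.K2E1MaassSelbergBracketsThree

namespace Summit.HodgeConjecture.HodgeConjecture.Cruxes.H413.K2E1MaassSelbergBracketsTwo

variable {F E : Type} [Field F] [NumberField F] [Field E] [NumberField E] [Algebra F E] {c : E ≃ₐ[F] E}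

/-! ## §1 The master lemma: `[𝟙_P(H) f_a, f′_{a′}]_β = K · ∫_𝓕 ‖x‖⁻¹ • 𝟙_P(‖x‖)·‖x‖^{a+ā′}·Ξ` (`U(J₂)`) -/

section Master

variable [MeasurableSpace (quasiSplit F E c 2).Adelic] [BorelSpace (quasiSplit F E c 2).Adelic]
  [MeasurableSpace (AdeleRing (𝓞 E) E)ˣ] [BorelSpace (AdeleRing (𝓞 E) E)ˣ]

/-- **THE MAASS–SELBERG BRACKET OF TWO FLAT SECTIONS, `B(F)`-WEIGHT LEVEL → IDELE CLASS GROUP (`U(J₂)`).**  `c² = 1`, `c ≠ 1`; `ν_G`, `μ_K`, `ν_I` Haar on `G(𝔸)`, `K_U`,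
`𝕀_E`; Iwasawa `hBK`; `𝓕` an idele class domain.  There is ONE `K > 0` such that for every covering weight `β` of `B(F)♯`, every Borel cut-off `P ⊆ ℝ≥0`, all Borel bounded left-`N(𝔸)`-
and left-`B(F)`-invariant coefficients `α, α′`, all exponents `a, a′`, and every Borel bounded `E^×`-invariant `Ξ` with **(hΞ) `∫_{K_U} α(tk)·conj α′(tk) dμ_K = Ξ(d₀ t)` for all
`t ∈ T(𝔸_F)`**, under the finiteness `∫⁻_𝓕 ‖x‖⁻¹·𝟙_P(‖x‖)·‖x‖^{Re(a+ā′)}·C_α C_α′ dν_I < ∞` (`2ρ_H = 1`: the weight is `δ_B⁻¹ = ‖x‖⁻¹`):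
`(β)·(𝟙_P(H) f_a · conj f′_{a′}) ∈ L¹(ν_G)` and **`∫ (β g)·𝟙_P(H g)·f_a(g)·conj f′_{a′}(g) dν_G = K · ∫_𝓕 ‖x‖⁻¹ • 𝟙_P(‖x‖)·‖x‖^{a + conj a′}·Ξ(x) dν_I`** — ★ (δ)\_two p857611 with
`Ψ := 𝟙_P(H)·f_a·conj f′_{a′}`, whose `K_U`-average is ★ (C1) §0 (`H(tk) = ‖d₀ t‖`, every `N`). [cite: MoeglinWaldspurger1995, IV.2.1] [cite: Arthur1980TraceFormulaII, §4] [cite: Garrett2018, §11.3] -/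
theorem exists_integral_weight_smul_cutoff_flatSectionU_mul_conj_eq_two (hc : c * c = 1) (hc1 : c ≠ 1)
    (νG : Measure (quasiSplit F E c 2).Adelic) [νG.IsHaarMeasure]
    (μK : Measure ((standardMaximalCompactGL 2 E).comap (adelicVal F E c 2 ((StdForm.antidiagonal 2).over E)) : Subgroup (quasiSplit F E c 2).Adelic))
    [μK.IsHaarMeasure]
    (νI : Measure (AdeleRing (𝓞 E) E)ˣ) [νI.IsHaarMeasure]
    (hBK : ∀ g : (quasiSplit F E c 2).Adelic, ∃ b ∈ borelAdelic F E c 2, ∃ k : (quasiSplit F E c 2).Adelic,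
      adelicVal F E c 2 ((StdForm.antidiagonal 2).over E) k ∈ standardMaximalCompactGL 2 E ∧ g = b * k)
    {𝓕 : Set (AdeleRing (𝓞 E) E)ˣ} (h𝓕 : IsIdeleClassDomain E 𝓕) :
    ∃ K : ℝ, 0 < K ∧
      ∀ {β : (quasiSplit F E c 2).Adelic → ℝ≥0∞}, IsCoveringWeight ((arithmeticBorel F E c 2).map (quasiSplit F E c 2).arithmeticSubgroup.subtype) β →
      ∀ {P : Set ℝ≥0}, MeasurableSet P →
      ∀ {α α' : (quasiSplit F E c 2).Adelic → ℂ}, Measurable α → Measurable α' →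
        (∀ (n : unipotentInBorel F E c 2) (y : (quasiSplit F E c 2).Adelic), α (((n : borelAdelic F E c 2) : (quasiSplit F E c 2).Adelic) * y) = α y) →
        (∀ (n : unipotentInBorel F E c 2) (y : (quasiSplit F E c 2).Adelic), α' (((n : borelAdelic F E c 2) : (quasiSplit F E c 2).Adelic) * y) = α' y) →
        (∀ b ∈ arithmeticBorel F E c 2, ∀ y : (quasiSplit F E c 2).Adelic, α ((b : (quasiSplit F E c 2).Adelic) * y) = α y) →
        (∀ b ∈ arithmeticBorel F E c 2, ∀ y : (quasiSplit F E c 2).Adelic, α' ((b : (quasiSplit F E c 2).Adelic) * y) = α' y) →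
      ∀ {Cα Cα' : ℝ}, (∀ x, ‖α x‖ ≤ Cα) → (∀ x, ‖α' x‖ ≤ Cα') →
      ∀ {a a' : ℂ} {Ξ : (AdeleRing (𝓞 E) E)ˣ → ℂ}, Measurable Ξ → (∀ k ∈ GaloisRepresentations.principalIdeles E, ∀ x, Ξ (k * x) = Ξ x) →
        (∀ t : torusInBorel F E c 2,
          ∫ k, α (((t : borelAdelic F E c 2) : (quasiSplit F E c 2).Adelic) * (k : (quasiSplit F E c 2).Adelic)) *
              conj (α' (((t : borelAdelic F E c 2) : (quasiSplit F E c 2).Adelic) * (k : (quasiSplit F E c 2).Adelic))) ∂μK =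
            Ξ (diagUnit (t : borelAdelic F E c 2).2 0)) →
        ∫⁻ x in 𝓕, (((IdeleClassGroup.ideleNorm E x)⁻¹ : ℝ≥0) : ℝ≥0∞) *
            ({x : (AdeleRing (𝓞 E) E)ˣ | IdeleClassGroup.ideleNorm E x ∈ P}.indicator
              (fun x => ENNReal.ofReal ((IdeleClassGroup.ideleNorm E x : ℝ) ^ (a + conj a').re * (Cα * Cα'))) x) ∂νI < ∞ →
        Integrable (fun g => (β g).toReal •
            ({y : (quasiSplit F E c 2).Adelic | borelHeight y ∈ P}.indicator (flatSectionU α a) g * conj (flatSectionU α' a' g))) νG ∧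
          ∫ g, (β g).toReal • ({y : (quasiSplit F E c 2).Adelic | borelHeight y ∈ P}.indicator (flatSectionU α a) g * conj (flatSectionU α' a' g)) ∂νG =
            (K : ℂ) * ∫ x in 𝓕, ((IdeleClassGroup.ideleNorm E x : ℝ))⁻¹ •
              {x : (AdeleRing (𝓞 E) E)ˣ | IdeleClassGroup.ideleNorm E x ∈ P}.indicator
                (fun x => ((IdeleClassGroup.ideleNorm E x : ℝ) : ℂ) ^ (a + conj a') * Ξ x) x ∂νI := by
  obtain ⟨K, hK0, hKt, -, hδ⟩ := exists_integral_weight_smul_eq_mul_setIntegral_ideleClass_two hc hc1 νG μK νI hBK h𝓕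
  refine ⟨K.toReal, ENNReal.toReal_pos hK0 hKt, ?_⟩
  intro β hβ P hP α α' hαm hα'm hαN hα'N hαB hα'B Cα Cα' hαC hα'C a a' Ξ hΞm hΞK hΞ hfin
  -- the integrand `Ψ`, its density `Φ` and majorant `Φm`
  have hSm : MeasurableSet {y : (quasiSplit F E c 2).Adelic | borelHeight y ∈ P} := measurable_borelHeight hP
  have hΨm : Measurable fun g => {y : (quasiSplit F E c 2).Adelic | borelHeight y ∈ P}.indicator (flatSectionU α a) g * conj (flatSectionU α' a' g) :=
    ((measurable_flatSectionU hαm a).indicator hSm).mul (Complex.continuous_conj.measurable.comp (measurable_flatSectionU hα'm a'))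
  have hΨN : ∀ (n : unipotentInBorel F E c 2) (y : (quasiSplit F E c 2).Adelic),
      {y : (quasiSplit F E c 2).Adelic | borelHeight y ∈ P}.indicator (flatSectionU α a) (((n : borelAdelic F E c 2) : (quasiSplit F E c 2).Adelic) * y) *
          conj (flatSectionU α' a' (((n : borelAdelic F E c 2) : (quasiSplit F E c 2).Adelic) * y)) =
        {y : (quasiSplit F E c 2).Adelic | borelHeight y ∈ P}.indicator (flatSectionU α a) y * conj (flatSectionU α' a' y) := by
    intro n y
    rw [cutoff_flatSectionU_mul_conj_apply, cutoff_flatSectionU_mul_conj_apply, borelHeight_unipotent_mul ((mem_unipotentInBorel_iff _).1 n.2), hαN n y, hα'N n y]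
  have hΨB : ∀ b ∈ arithmeticBorel F E c 2, ∀ y : (quasiSplit F E c 2).Adelic,
      {y : (quasiSplit F E c 2).Adelic | borelHeight y ∈ P}.indicator (flatSectionU α a) ((b : (quasiSplit F E c 2).Adelic) * y) *
          conj (flatSectionU α' a' ((b : (quasiSplit F E c 2).Adelic) * y)) =
        {y : (quasiSplit F E c 2).Adelic | borelHeight y ∈ P}.indicator (flatSectionU α a) y * conj (flatSectionU α' a' y) := by
    intro b hb y
    rw [cutoff_flatSectionU_mul_conj_apply, cutoff_flatSectionU_mul_conj_apply, K2E1TruncatedEisensteinExplicit.borelHeight_arithmeticBorel_mul hb, hαB b hb y, hα'B b hb y]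
  have hIm : Measurable fun x : (AdeleRing (𝓞 E) E)ˣ => IdeleClassGroup.ideleNorm E x := (continuous_ideleNorm_holds E).measurable
  have hSIm : MeasurableSet {x : (AdeleRing (𝓞 E) E)ˣ | IdeleClassGroup.ideleNorm E x ∈ P} := hIm hP
  have hpowm : Measurable fun x : (AdeleRing (𝓞 E) E)ˣ => ((IdeleClassGroup.ideleNorm E x : ℝ) : ℂ) ^ (a + conj a') :=
    (Complex.measurable_ofReal.comp hIm.coe_nnreal_real).pow_const _
  have hΦm' : Measurable fun x => {x : (AdeleRing (𝓞 E) E)ˣ | IdeleClassGroup.ideleNorm E x ∈ P}.indicator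
      (fun x => ((IdeleClassGroup.ideleNorm E x : ℝ) : ℂ) ^ (a + conj a') * Ξ x) x := (hpowm.mul hΞm).indicator hSIm
  have hΦK : ∀ k ∈ GaloisRepresentations.principalIdeles E, ∀ x,
      {x : (AdeleRing (𝓞 E) E)ˣ | IdeleClassGroup.ideleNorm E x ∈ P}.indicator (fun x => ((IdeleClassGroup.ideleNorm E x : ℝ) : ℂ) ^ (a + conj a') * Ξ x) (k * x) =
        {x : (AdeleRing (𝓞 E) E)ˣ | IdeleClassGroup.ideleNorm E x ∈ P}.indicator (fun x => ((IdeleClassGroup.ideleNorm E x : ℝ) : ℂ) ^ (a + conj a') * Ξ x) x := by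
    intro k hk x
    have hn : IdeleClassGroup.ideleNorm E (k * x) = IdeleClassGroup.ideleNorm E x := by rw [map_mul, ideleNorm_principal hk, one_mul]
    by_cases hx : IdeleClassGroup.ideleNorm E x ∈ P
    · rw [indicator_of_mem (show k * x ∈ {x : (AdeleRing (𝓞 E) E)ˣ | IdeleClassGroup.ideleNorm E x ∈ P} by rw [Set.mem_setOf_eq, hn]; exact hx),
        indicator_of_mem (show x ∈ {x : (AdeleRing (𝓞 E) E)ˣ | IdeleClassGroup.ideleNorm E x ∈ P} from hx), hn, hΞK k hk x]
    · rw [indicator_of_notMem (show k * x ∉ {x : (AdeleRing (𝓞 E) E)ˣ | IdeleClassGroup.ideleNorm E x ∈ P} by rw [Set.mem_setOf_eq, hn]; exact hx),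
        indicator_of_notMem (show x ∉ {x : (AdeleRing (𝓞 E) E)ˣ | IdeleClassGroup.ideleNorm E x ∈ P} from hx)]
  have hΦmm : Measurable fun x => {x : (AdeleRing (𝓞 E) E)ˣ | IdeleClassGroup.ideleNorm E x ∈ P}.indicator
      (fun x => ENNReal.ofReal ((IdeleClassGroup.ideleNorm E x : ℝ) ^ (a + conj a').re * (Cα * Cα'))) x :=
    (ENNReal.measurable_ofReal.comp ((hIm.coe_nnreal_real.pow_const _).mul_const _)).indicator hSIm
  have hΦmK : ∀ k ∈ GaloisRepresentations.principalIdeles E, ∀ x,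
      {x : (AdeleRing (𝓞 E) E)ˣ | IdeleClassGroup.ideleNorm E x ∈ P}.indicator
          (fun x => ENNReal.ofReal ((IdeleClassGroup.ideleNorm E x : ℝ) ^ (a + conj a').re * (Cα * Cα'))) (k * x) =
        {x : (AdeleRing (𝓞 E) E)ˣ | IdeleClassGroup.ideleNorm E x ∈ P}.indicator
          (fun x => ENNReal.ofReal ((IdeleClassGroup.ideleNorm E x : ℝ) ^ (a + conj a').re * (Cα * Cα'))) x := by
    intro k hk x
    have hn : IdeleClassGroup.ideleNorm E (k * x) = IdeleClassGroup.ideleNorm E x := by rw [map_mul, ideleNorm_principal hk, one_mul]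
    by_cases hx : IdeleClassGroup.ideleNorm E x ∈ P
    · rw [indicator_of_mem (show k * x ∈ {x : (AdeleRing (𝓞 E) E)ˣ | IdeleClassGroup.ideleNorm E x ∈ P} by rw [Set.mem_setOf_eq, hn]; exact hx),
        indicator_of_mem (show x ∈ {x : (AdeleRing (𝓞 E) E)ˣ | IdeleClassGroup.ideleNorm E x ∈ P} from hx), hn]
    · rw [indicator_of_notMem (show k * x ∉ {x : (AdeleRing (𝓞 E) E)ˣ | IdeleClassGroup.ideleNorm E x ∈ P} by rw [Set.mem_setOf_eq, hn]; exact hx),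
        indicator_of_notMem (show x ∉ {x : (AdeleRing (𝓞 E) E)ˣ | IdeleClassGroup.ideleNorm E x ∈ P} from hx)]
  -- along the torus: `H(t k) = ‖d₀ t‖`
  have hHtk : ∀ (t : torusInBorel F E c 2) (k : ((standardMaximalCompactGL 2 E).comap (adelicVal F E c 2 ((StdForm.antidiagonal 2).over E)) :
      Subgroup (quasiSplit F E c 2).Adelic)),
      borelHeight (((t : borelAdelic F E c 2) : (quasiSplit F E c 2).Adelic) * (k : (quasiSplit F E c 2).Adelic)) = IdeleClassGroup.ideleNorm E (diagUnit (t : borelAdelic F E c 2).2 0) := by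
    intro t k
    rw [borelHeight_mul_of_mem_comap_standardMaximalCompactGL k.2, borelHeight_coe_eq_ideleNorm_diagUnit]
  -- the `K_U`-average
  have hAvg : ∀ t : torusInBorel F E c 2,
      ∫ k, {y : (quasiSplit F E c 2).Adelic | borelHeight y ∈ P}.indicator (flatSectionU α a)
            (((t : borelAdelic F E c 2) : (quasiSplit F E c 2).Adelic) * (k : (quasiSplit F E c 2).Adelic)) *
          conj (flatSectionU α' a' (((t : borelAdelic F E c 2) : (quasiSplit F E c 2).Adelic) * (k : (quasiSplit F E c 2).Adelic))) ∂μK =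
        {x : (AdeleRing (𝓞 E) E)ˣ | IdeleClassGroup.ideleNorm E x ∈ P}.indicator (fun x => ((IdeleClassGroup.ideleNorm E x : ℝ) : ℂ) ^ (a + conj a') * Ξ x)
          (diagUnit (t : borelAdelic F E c 2).2 0) := by
    intro t
    simp_rw [cutoff_flatSectionU_mul_conj_apply, hHtk t]
    rw [integral_const_mul, hΞ t]
    by_cases ht : IdeleClassGroup.ideleNorm E (diagUnit (t : borelAdelic F E c 2).2 0) ∈ P
    · rw [indicator_of_mem ht, indicator_of_mem (show diagUnit (t : borelAdelic F E c 2).2 0 ∈ {x : (AdeleRing (𝓞 E) E)ˣ | IdeleClassGroup.ideleNorm E x ∈ P} from ht),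
        one_mul]
    · rw [indicator_of_notMem ht, indicator_of_notMem (show diagUnit (t : borelAdelic F E c 2).2 0 ∉ {x : (AdeleRing (𝓞 E) E)ˣ | IdeleClassGroup.ideleNorm E x ∈ P} from ht),
        zero_mul, zero_mul]
  -- the majorant along `T(𝔸)·K_U`
  have hMaj : ∀ (t : torusInBorel F E c 2) (k : ((standardMaximalCompactGL 2 E).comap (adelicVal F E c 2 ((StdForm.antidiagonal 2).over E)) :
      Subgroup (quasiSplit F E c 2).Adelic)),
      ‖{y : (quasiSplit F E c 2).Adelic | borelHeight y ∈ P}.indicator (flatSectionU α a)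
            (((t : borelAdelic F E c 2) : (quasiSplit F E c 2).Adelic) * (k : (quasiSplit F E c 2).Adelic)) *
          conj (flatSectionU α' a' (((t : borelAdelic F E c 2) : (quasiSplit F E c 2).Adelic) * (k : (quasiSplit F E c 2).Adelic)))‖ₑ ≤
        {x : (AdeleRing (𝓞 E) E)ˣ | IdeleClassGroup.ideleNorm E x ∈ P}.indicator
          (fun x => ENNReal.ofReal ((IdeleClassGroup.ideleNorm E x : ℝ) ^ (a + conj a').re * (Cα * Cα'))) (diagUnit (t : borelAdelic F E c 2).2 0) := by
    intro t k
    rw [← ofReal_norm]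
    refine (ENNReal.ofReal_le_ofReal (norm_cutoff_flatSectionU_mul_conj_le P hαC hα'C a a' _)).trans (le_of_eq ?_)
    rw [hHtk t k]
    by_cases ht : IdeleClassGroup.ideleNorm E (diagUnit (t : borelAdelic F E c 2).2 0) ∈ P
    · rw [indicator_of_mem ht, indicator_of_mem (show diagUnit (t : borelAdelic F E c 2).2 0 ∈ {x : (AdeleRing (𝓞 E) E)ˣ | IdeleClassGroup.ideleNorm E x ∈ P} from ht),
        one_mul]
    · rw [indicator_of_notMem ht, indicator_of_notMem (show diagUnit (t : borelAdelic F E c 2).2 0 ∉ {x : (AdeleRing (𝓞 E) E)ˣ | IdeleClassGroup.ideleNorm E x ∈ P} from ht),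
        zero_mul, ENNReal.ofReal_zero]
  obtain ⟨hI, -, hE⟩ := hδ β hβ _ hΨm hΨN hΨB _ hΦm' hΦK hAvg _ hΦmm hΦmK hMaj hfin
  exact ⟨hI, hE⟩

end Master

/-! ## §2 The two cut-offs `{‖x‖ ≤ T}`, `{T < ‖x‖}` in ★ `maassSelberg_inner_truncation_two`'s token shape, finiteness discharged (★ p857444 ∕ ★ p857517) -/

section Instances

variable [MeasurableSpace (quasiSplit F E c 2).Adelic] [BorelSpace (quasiSplit F E c 2).Adelic]
  [MeasurableSpace (AdeleRing (𝓞 E) E)ˣ] [BorelSpace (AdeleRing (𝓞 E) E)ˣ]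

omit [MeasurableSpace (quasiSplit F E c 2).Adelic] [BorelSpace (quasiSplit F E c 2).Adelic] [MeasurableSpace (AdeleRing (𝓞 E) E)ˣ] [BorelSpace (AdeleRing (𝓞 E) E)ˣ] in
/-- At `N = 2` the `δ_B⁻¹ = ‖x‖⁻¹` weight shifts the real exponent of the majorant by `−1`: `‖x‖⁻¹·𝟙_P·(‖x‖^{σ} C) = C·𝟙_P·‖x‖^{σ−1}` in `[0,∞]`. [folklore] -/
theorem norm_inv_mul_indicator_ofReal_rpow (P : Set ℝ≥0) (σ : ℝ) {C : ℝ} (hC : 0 ≤ C) (x : (AdeleRing (𝓞 E) E)ˣ) :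
    (((IdeleClassGroup.ideleNorm E x)⁻¹ : ℝ≥0) : ℝ≥0∞) *
        {x : (AdeleRing (𝓞 E) E)ˣ | IdeleClassGroup.ideleNorm E x ∈ P}.indicator (fun x => ENNReal.ofReal ((IdeleClassGroup.ideleNorm E x : ℝ) ^ σ * C)) x =
      ENNReal.ofReal C * {x : (AdeleRing (𝓞 E) E)ˣ | IdeleClassGroup.ideleNorm E x ∈ P}.indicator
        (fun x => ENNReal.ofReal ((IdeleClassGroup.ideleNorm E x : ℝ) ^ (σ - 1))) x := by
  have hr : (0 : ℝ) < (IdeleClassGroup.ideleNorm E x : ℝ) := ideleNorm_real_pos x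
  by_cases hx : IdeleClassGroup.ideleNorm E x ∈ P
  · rw [indicator_of_mem (show x ∈ {x : (AdeleRing (𝓞 E) E)ˣ | IdeleClassGroup.ideleNorm E x ∈ P} from hx),
      indicator_of_mem (show x ∈ {x : (AdeleRing (𝓞 E) E)ˣ | IdeleClassGroup.ideleNorm E x ∈ P} from hx), ENNReal.coe_nnreal_eq,
      ← ENNReal.ofReal_mul (by positivity), ← ENNReal.ofReal_mul hC, NNReal.coe_inv]
    congr 1
    rw [show σ = (σ - 1) + 1 by ring, Real.rpow_add hr, Real.rpow_one, add_sub_cancel_right]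
    field_simp
  · rw [indicator_of_notMem (show x ∉ {x : (AdeleRing (𝓞 E) E)ˣ | IdeleClassGroup.ideleNorm E x ∈ P} from hx),
      indicator_of_notMem (show x ∉ {x : (AdeleRing (𝓞 E) E)ˣ | IdeleClassGroup.ideleNorm E x ∈ P} from hx), mul_zero, mul_zero]

/-- **THE TWO CUT-OFFS IN ★ `maassSelberg_inner_truncation_two`'s TOKEN SHAPE** (`hδ₁…hδ₄`, `hi₁…hi₄`), ONE constant `K` for both: for `0 < T`,
(≤) `{y | H y ≤ T}` ↦ `{x | (‖x‖:ℝ) ≤ (T:ℝ)}` under `1 < Re(a + conj a′)` (⟺ `0 < Re s`, `s + 1 = a + ā′`; finiteness = Tate at the cut-off ★ p857444 `setLIntegral_indicator_ideleNorm_rpow_eq`),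
(>) `{y | T < H y}` ↦ `{x | (T:ℝ) < (‖x‖:ℝ)}` under `Re(a + conj a′) < 1` (⟺ `0 < Re s`, `−s + 1 = a + ā′`; finiteness = the mirror ★ p857517 `setLIntegral_indicator_lt_rpow_neg`):
`(β)·(𝟙·f_a·conj f′_{a′}) ∈ L¹(ν_G)` and **`∫ (β g)·𝟙(H g)·f_a(g)·conj f′_{a′}(g) dν_G = K · ∫_𝓕 ‖x‖⁻¹ • 𝟙(‖x‖)·‖x‖^{a + conj a′}·Ξ(x) dν_I`** (`2ρ_H = 1`).
[cite: MoeglinWaldspurger1995, IV.2.1] [cite: Arthur1980TraceFormulaII, §4] [cite: Garrett2018, §11.3] -/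
theorem exists_integral_weight_smul_cutoffs_flatSectionU_mul_conj_eq_two (hc : c * c = 1) (hc1 : c ≠ 1)
    (νG : Measure (quasiSplit F E c 2).Adelic) [νG.IsHaarMeasure]
    (μK : Measure ((standardMaximalCompactGL 2 E).comap (adelicVal F E c 2 ((StdForm.antidiagonal 2).over E)) : Subgroup (quasiSplit F E c 2).Adelic))
    [μK.IsHaarMeasure]
    (νI : Measure (AdeleRing (𝓞 E) E)ˣ) [νI.IsHaarMeasure]
    (hBK : ∀ g : (quasiSplit F E c 2).Adelic, ∃ b ∈ borelAdelic F E c 2, ∃ k : (quasiSplit F E c 2).Adelic,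
      adelicVal F E c 2 ((StdForm.antidiagonal 2).over E) k ∈ standardMaximalCompactGL 2 E ∧ g = b * k)
    {𝓕 : Set (AdeleRing (𝓞 E) E)ˣ} (h𝓕 : IsIdeleClassDomain E 𝓕) :
    ∃ K : ℝ, 0 < K ∧
      (∀ {β : (quasiSplit F E c 2).Adelic → ℝ≥0∞}, IsCoveringWeight ((arithmeticBorel F E c 2).map (quasiSplit F E c 2).arithmeticSubgroup.subtype) β →
      ∀ {T : ℝ≥0}, 0 < T →
      ∀ {α α' : (quasiSplit F E c 2).Adelic → ℂ}, Measurable α → Measurable α' →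
        (∀ (n : unipotentInBorel F E c 2) (y : (quasiSplit F E c 2).Adelic), α (((n : borelAdelic F E c 2) : (quasiSplit F E c 2).Adelic) * y) = α y) →
        (∀ (n : unipotentInBorel F E c 2) (y : (quasiSplit F E c 2).Adelic), α' (((n : borelAdelic F E c 2) : (quasiSplit F E c 2).Adelic) * y) = α' y) →
        (∀ b ∈ arithmeticBorel F E c 2, ∀ y : (quasiSplit F E c 2).Adelic, α ((b : (quasiSplit F E c 2).Adelic) * y) = α y) →
        (∀ b ∈ arithmeticBorel F E c 2, ∀ y : (quasiSplit F E c 2).Adelic, α' ((b : (quasiSplit F E c 2).Adelic) * y) = α' y) →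
      ∀ {Cα Cα' : ℝ}, (∀ x, ‖α x‖ ≤ Cα) → (∀ x, ‖α' x‖ ≤ Cα') →
      ∀ {a a' : ℂ} {Ξ : (AdeleRing (𝓞 E) E)ˣ → ℂ}, Measurable Ξ → (∀ k ∈ GaloisRepresentations.principalIdeles E, ∀ x, Ξ (k * x) = Ξ x) →
        (∀ t : torusInBorel F E c 2,
          ∫ k, α (((t : borelAdelic F E c 2) : (quasiSplit F E c 2).Adelic) * (k : (quasiSplit F E c 2).Adelic)) *
              conj (α' (((t : borelAdelic F E c 2) : (quasiSplit F E c 2).Adelic) * (k : (quasiSplit F E c 2).Adelic))) ∂μK =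
            Ξ (diagUnit (t : borelAdelic F E c 2).2 0)) →
        (1 < (a + conj a').re →
          Integrable (fun g => (β g).toReal •
              ({y : (quasiSplit F E c 2).Adelic | borelHeight y ≤ T}.indicator (flatSectionU α a) g * conj (flatSectionU α' a' g))) νG ∧
            ∫ g, (β g).toReal • ({y : (quasiSplit F E c 2).Adelic | borelHeight y ≤ T}.indicator (flatSectionU α a) g * conj (flatSectionU α' a' g)) ∂νG =
              (K : ℂ) * ∫ x in 𝓕, ((IdeleClassGroup.ideleNorm E x : ℝ))⁻¹ •
                {x : (AdeleRing (𝓞 E) E)ˣ | (IdeleClassGroup.ideleNorm E x : ℝ) ≤ (T : ℝ)}.indicator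
                  (fun x => ((IdeleClassGroup.ideleNorm E x : ℝ) : ℂ) ^ (a + conj a') * Ξ x) x ∂νI) ∧
        ((a + conj a').re < 1 →
          Integrable (fun g => (β g).toReal •
              ({y : (quasiSplit F E c 2).Adelic | T < borelHeight y}.indicator (flatSectionU α a) g * conj (flatSectionU α' a' g))) νG ∧
            ∫ g, (β g).toReal • ({y : (quasiSplit F E c 2).Adelic | T < borelHeight y}.indicator (flatSectionU α a) g * conj (flatSectionU α' a' g)) ∂νG =
              (K : ℂ) * ∫ x in 𝓕, ((IdeleClassGroup.ideleNorm E x : ℝ))⁻¹ •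
                {x : (AdeleRing (𝓞 E) E)ˣ | (T : ℝ) < (IdeleClassGroup.ideleNorm E x : ℝ)}.indicator
                  (fun x => ((IdeleClassGroup.ideleNorm E x : ℝ) : ℂ) ^ (a + conj a') * Ξ x) x ∂νI)) := by
  obtain ⟨K, hK, hM⟩ := exists_integral_weight_smul_cutoff_flatSectionU_mul_conj_eq_two hc hc1 νG μK νI hBK h𝓕
  refine ⟨K, hK, ?_⟩
  intro β hβ T hT α α' hαm hα'm hαN hα'N hαB hα'B Cα Cα' hαC hα'C a a' Ξ hΞm hΞK hΞ
  have hCC : 0 ≤ Cα * Cα' := mul_nonneg ((norm_nonneg _).trans (hαC 1)) ((norm_nonneg _).trans (hα'C 1))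
  have hT' : (0 : ℝ) < (T : ℝ) := NNReal.coe_pos.2 hT
  refine ⟨fun ha => ?_, fun ha => ?_⟩
  · have hfin : ∫⁻ x in 𝓕, (((IdeleClassGroup.ideleNorm E x)⁻¹ : ℝ≥0) : ℝ≥0∞) *
        ({x : (AdeleRing (𝓞 E) E)ˣ | IdeleClassGroup.ideleNorm E x ∈ Set.Iic T}.indicator
          (fun x => ENNReal.ofReal ((IdeleClassGroup.ideleNorm E x : ℝ) ^ (a + conj a').re * (Cα * Cα'))) x) ∂νI < ∞ := by
      simp_rw [norm_inv_mul_indicator_ofReal_rpow (Set.Iic T) _ hCC]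
      rw [lintegral_const_mul' _ _ ENNReal.ofReal_ne_top,
        show {x : (AdeleRing (𝓞 E) E)ˣ | IdeleClassGroup.ideleNorm E x ∈ Set.Iic T} = {x : (AdeleRing (𝓞 E) E)ˣ | IdeleClassGroup.ideleNorm E x ≤ T} from rfl,
        K2E1BorelParabolicIntegralU3.setLIntegral_indicator_ideleNorm_rpow_eq E νI h𝓕 (by linarith) T]
      exact ENNReal.mul_lt_top ENNReal.ofReal_lt_top (ENNReal.mul_lt_top (idelicCovolume_lt_top νI) ENNReal.ofReal_lt_top)
    have h := hM hβ measurableSet_Iic hαm hα'm hαN hα'N hαB hα'B hαC hα'C hΞm hΞK hΞ hfin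
    rw [(setOf_ideleNorm_mem_Iic_eq (E := E) T).1] at h
    exact h
  · have hfin : ∫⁻ x in 𝓕, (((IdeleClassGroup.ideleNorm E x)⁻¹ : ℝ≥0) : ℝ≥0∞) *
        ({x : (AdeleRing (𝓞 E) E)ˣ | IdeleClassGroup.ideleNorm E x ∈ Set.Ioi T}.indicator
          (fun x => ENNReal.ofReal ((IdeleClassGroup.ideleNorm E x : ℝ) ^ (a + conj a').re * (Cα * Cα'))) x) ∂νI < ∞ := by
      simp_rw [norm_inv_mul_indicator_ofReal_rpow (Set.Ioi T) _ hCC]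
      rw [lintegral_const_mul' _ _ ENNReal.ofReal_ne_top, (setOf_ideleNorm_mem_Iic_eq (E := E) T).2,
        show (a + conj a').re - 1 = -(1 - (a + conj a').re) by ring,
        setLIntegral_indicator_lt_rpow_neg νI (h𝓕.isFundamentalDomain νI) (by linarith) hT']
      exact ENNReal.mul_lt_top ENNReal.ofReal_lt_top (ENNReal.mul_lt_top (idelicCovolume_lt_top νI) ENNReal.ofReal_lt_top)
    have h := hM hβ measurableSet_Ioi hαm hα'm hαN hα'N hαB hα'B hαC hα'C hΞm hΞK hΞ hfin
    rw [(setOf_ideleNorm_mem_Iic_eq (E := E) T).2] at h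
    exact h

end Instances

end Summit.HodgeConjecture.HodgeConjecture.Cruxes.H413.K2E1MaassSelbergBracketsTwo

end
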